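import Summits.MatrixMultiplication.MatrixMultiplication.Theorems.ObstructionDescentCornerEquations
import Summits.MatrixMultiplication.MatrixMultiplication.Theorems.ObstructionDescentDegreeAxisNecessary
import Literature.Computability.AlgebraicComplexity.SchoenhageTauBini
import Literature.Computability.AlgebraicComplexity.BorderRankRestriction
import Literature.Computability.AlgebraicComplexity.AsymptoticRankBorderRank
import Literature.Computability.AlgebraicComplexity.AlderStrassenProofs

set_option linter.dupNamespace false

/-!
# Secant generation in polynomial degree: MM-free laws beneath the joint residual (decomp-mm · lens 3 · gen 20)

Route `route-MatrixMultiplication-ObstructionDescent` (sub-problem `MatrixMultiplication`, `ω(ℂ) = 2`).  The declared joint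
residual `B = JointBlindnessDecides` (item `stmt-MatrixMultiplication-30890`) is discharged by any law saying that the
polynomial-degree membership tests of the format-`m` secant variety `σ_m(ℂ^m ⊗ ℂ^m ⊗ ℂ^m)` are SOUND FOR BORDER RANK.  Two such
laws, both free of matrix multiplication, are typed here in the orbit phrasing of the route (a «degree-`≤ m^c` test of `σ_m`» is a
polynomial of degree `≤ m^c` vanishing on `GL_m³·⟨m⟩`, equivalently — `passesTests_iff_rankVanishing` — on every tensor of rank
`≤ m`):

* `G₁` «secants are cut out in polynomial degree»: `∃ c m₀, ∀ m ≥ m₀`, a tensor passing every degree-`≤ m^c` test of `σ_m` has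
  border rank `bR(t) ≤ m`; by Alder's theorem (`alder_secantVariety_eq_setOf_algBorderRank_le_holds`) this says exactly that
  `σ_m(ℂ^m⊗ℂ^m⊗ℂ^m) = {bR ≤ m}` is cut out SET-THEORETICALLY by its equations of degree `≤ m^c` (`secantsCutOut_iff_zariski`);
* `G₃` «tests bound border rank up to polynomial loss»: `∀ δ > 0, ∃ c m₀, ∀ m ≥ m₀`, passing the degree-`≤ m^c` tests of `σ_m`
  forces `bR(t) ≤ m^{1+δ}`.

Kernel (sorry-free, standard axioms): `G₁ ⟹ G₃` (`testsBoundBorderRank_of_secantsCutOut`); `G₁ ⟹ A`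
(`polyDegreeTestBoundsAsymptoticRank_of_secantsCutOut`, `R̃ ≤ bR`); and the summit from the degree child and the weakest law,
**`E ∧ G₃ ⟹ ω(ℂ) = 2`** (`summit_of_noPolyDegreeObstruction_of_testsBoundBorderRank`): `E` puts `pad_m⟨n,n,n⟩`, `m = ⌈n^{2+δ}⌉`,
through every degree-`≤ m^c` test (evaluate the orbit-vanishing at `A = B = C = 1`), `G₃` gives `bR(pad_m⟨n,n,n⟩) ≤ m^{1+δ}`,
restriction gives `bR(⟨n,n,n⟩) ≤ bR(pad_m⟨n,n,n⟩)` (`algBorderRank_precomp_le`), and Bini's theorem in Bläser's form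
(`Blaser2013_thm66_holds.cubic`: `bR(⟨n,n,n⟩) ≤ r ⟹ ω ≤ log_n r`) gives `ω ≤ (1+δ)(2+2δ)`; `δ → 0`.  Hence
`G₃ ⟹ JointBlindnessDecides` and `G₁ ⟹ JointBlindnessDecides` — LINES beneath the residual, landed; unlike the gen-8 law `A`
(asymptotic rank) the border-rank glue uses neither `R̃(⟨n,n,n⟩) = n^ω` nor the asymptotic spectrum.

No proposition is defined here.  `G₃` is the route's aside decl `SecantTestsSoundUpToPolyLoss` (rev 9, item
`stmt-MatrixMultiplication-27291`); `G₁` is deliberately given NO decl and is spelled inline (§2): it is the exact, loss-free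
form and it LEANS FALSE — near-generic secants of small codimension inside SUB-formats have enormous initial degree
(`I(σ_6(ℂ⁴⊗ℂ⁴⊗ℂ⁴))` starts in degree 19; `σ_18(ℂ⁷⊗ℂ⁷⊗ℂ⁷)` is a hypersurface with `I_{186999} = 0`, HIL13, so inside format
`m = 18` the cut-out degree is `≥ 187000 ≥ 18^{4.2}`), while those witnesses have border rank `m + O(√m) ≪ m^{1+δ}` and do
not touch `G₃`: the polynomial loss in `G₃` is exactly what this mechanism forces.
[cite: Blaser2013, Thm. 6.6, Def. 6.1, Lemma 5.4; BurgisserClausenShokrollahi1997, Thm. (20.3), Lemma (15.27);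
BurgisserIkenmeyer2011, §2 (2.2), §3.1, §5; LandsbergGCT2017, §7.1, §8.3.2]
-/

noncomputable section

open scoped BigOperators
open Finset Filter

namespace Summit.MatrixMultiplication.MatrixMultiplication.Theorems.ObstructionDescentSecantGeneration

open Literature.Computability.AlgebraicComplexity (tensorRank matMulTensor unitTensor actTensor actTensor_one
  algBorderRank algBorderRank_precomp_le omega omega_two_le Blaser2013_thm66 Blaser2013_thm66_holds asymptoticRank
  asymptoticRank_le_algBorderRank tensorZariskiClosure mem_tensorZariskiClosure_iff uncurryTensor
  setOf_algBorderRank_le_subset_tensorZariskiClosure alder_secantVariety_eq_setOf_algBorderRank_le_holds)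
open Summit.MatrixMultiplication.MatrixMultiplication.Theorems.ObstructionCalculus
open Summit.MatrixMultiplication.MatrixMultiplication.Theorems.ObstructionDescentCornerEquations
open Summit.MatrixMultiplication.MatrixMultiplication.Theorems.ObstructionDescentDegreeAxisNecessary
open Summit.MatrixMultiplication.MatrixMultiplication.Theses.ObstructionDescent

variable {m : ℕ}

/-! ## §1 What «passing the degree-`≤ D` tests of `σ_m`» means -/

/-- The tests of `σ_m(ℂ^m⊗ℂ^m⊗ℂ^m)` in the route's orbit phrasing (polynomials vanishing on `GL_m³·⟨m⟩`) are exactly the polynomials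
vanishing at every tensor of rank `≤ m` in format `m` (`GL_m³·⟨m⟩` is Zariski dense in the rank-`≤ m` locus; tree
`evalT_eq_zero_of_tensorRank_le`, `actTensor_unitTensor`, `tensorRank_fromCols_le`). [cite: BurgisserIkenmeyer2011, §3.1] -/
theorem mem_orbitVanishing_unitTensor_iff_rank {f : MvPolynomial (Idx m) ℂ} :
    f ∈ orbitVanishing (unitTensor ℂ m) ↔ ∀ s : Tensor ℂ m, tensorRank s ≤ m → evalT s f = 0 := by
  refine ⟨fun hf s hs => evalT_eq_zero_of_tensorRank_le hf hs, fun h => mem_orbitVanishing.2 ?_⟩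
  intro A B C _ _ _
  rw [actTensor_unitTensor]
  exact h _ (tensorRank_fromCols_le A B C)

/-- Hence «`t` passes every degree-`≤ D` test of `σ_m`» (orbit phrasing) iff every polynomial of degree `≤ D` vanishing on all
rank-`≤ m` tensors vanishes at `t`. [cite: BurgisserIkenmeyer2011, §3.1] -/
theorem passesTests_iff_rankVanishing {D : ℕ} {t : Tensor ℂ m} :
    (∀ f : MvPolynomial (Idx m) ℂ, f.totalDegree ≤ D → f ∈ orbitVanishing (unitTensor ℂ m) → evalT t f = 0) ↔
    (∀ f : MvPolynomial (Idx m) ℂ, f.totalDegree ≤ D → (∀ s : Tensor ℂ m, tensorRank s ≤ m → evalT s f = 0) →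
      evalT t f = 0) := by
  refine ⟨fun h f hd hf => h f hd (mem_orbitVanishing_unitTensor_iff_rank.2 hf),
    fun h f hd hf => h f hd (mem_orbitVanishing_unitTensor_iff_rank.1 hf)⟩

/-- Every point of the secant variety `σ_m = tensorZariskiClosure {rank ≤ m}` passes all tests (of every degree): the cheap half
of «cut out». [cite: BurgisserClausenShokrollahi1997, Thm. (20.3)] -/
theorem passesTests_of_mem_tensorZariskiClosure {D : ℕ} {t : Tensor ℂ m}
    (ht : t ∈ tensorZariskiClosure {s : Tensor ℂ m | tensorRank s ≤ m}) :
    ∀ f : MvPolynomial (Idx m) ℂ, f.totalDegree ≤ D → f ∈ orbitVanishing (unitTensor ℂ m) → evalT t f = 0 := by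
  intro f _ hf
  have key := (mem_tensorZariskiClosure_iff _ t).1 ht f (fun s hs => by
    rw [← MvPolynomial.coe_aeval_eq_eval]
    exact mem_orbitVanishing_unitTensor_iff_rank.1 hf s hs)
  rwa [← MvPolynomial.coe_aeval_eq_eval] at key

/-- **`G₁` at one scale is set-theoretic generation in degree `≤ D`** (Alder): «every tensor passing the degree-`≤ D` tests of
`σ_m` has `bR ≤ m`» iff «the common zero locus of the equations of `σ_m(ℂ^m⊗ℂ^m⊗ℂ^m)` of degree `≤ D` is `σ_m` itself».
[cite: BurgisserClausenShokrollahi1997, Thm. (20.3) (Alder)] -/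
theorem secantsCutOut_iff_zariski {D : ℕ} :
    (∀ t : Tensor ℂ m, (∀ f : MvPolynomial (Idx m) ℂ, f.totalDegree ≤ D → f ∈ orbitVanishing (unitTensor ℂ m) →
      evalT t f = 0) → algBorderRank t ≤ m) ↔
    {t : Tensor ℂ m | ∀ f : MvPolynomial (Idx m) ℂ, f.totalDegree ≤ D → f ∈ orbitVanishing (unitTensor ℂ m) →
      evalT t f = 0} = tensorZariskiClosure {s : Tensor ℂ m | tensorRank s ≤ m} := by
  have hA := @alder_secantVariety_eq_setOf_algBorderRank_le_holds ℂ _ _ (Fin m) (Fin m) (Fin m) _ _ _ m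
  constructor
  · intro h
    refine Set.Subset.antisymm (fun t ht => ?_) (fun t ht => passesTests_of_mem_tensorZariskiClosure ht)
    rw [hA]
    exact h t ht
  · intro h t ht
    have : t ∈ tensorZariskiClosure {s : Tensor ℂ m | tensorRank s ≤ m} := h ▸ ht
    rw [hA] at this
    exact this

/-- Zero locus ⟹ border rank: a tensor annihilated by every polynomial vanishing on the rank-`≤ r` tensors has `bR ≤ r`
(Alder's theorem, the deep inclusion; tree `alder_secantVariety_eq_setOf_algBorderRank_le_holds`).
[cite: BurgisserClausenShokrollahi1997, Thm. (20.3) (Alder)] -/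
theorem algBorderRank_le_of_zeroLocus {r : ℕ} {t : Tensor ℂ m}
    (h : ∀ f : MvPolynomial (Idx m) ℂ, (∀ s : Tensor ℂ m, tensorRank s ≤ r → evalT s f = 0) → evalT t f = 0) :
    algBorderRank t ≤ r := by
  have hA := @alder_secantVariety_eq_setOf_algBorderRank_le_holds ℂ _ _ (Fin m) (Fin m) (Fin m) _ _ _ r
  have ht : t ∈ tensorZariskiClosure {s : Tensor ℂ m | tensorRank s ≤ r} := by
    refine (mem_tensorZariskiClosure_iff _ t).2 fun P hP => ?_
    have key := h P (fun s hs => by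
      have h' := hP s hs
      rwa [← MvPolynomial.coe_aeval_eq_eval] at h')
    rwa [← MvPolynomial.coe_aeval_eq_eval]
  rw [hA] at ht
  exact ht

/-- Border rank ⟹ zero locus (the elementary inclusion `{bR ≤ r} ⊆ σ_r`; tree
`setOf_algBorderRank_le_subset_tensorZariskiClosure`). [cite: BurgisserClausenShokrollahi1997, Thm. (20.24) (proof)] -/
theorem zeroLocus_of_algBorderRank_le {r : ℕ} {t : Tensor ℂ m} (ht : algBorderRank t ≤ r) :
    ∀ f : MvPolynomial (Idx m) ℂ, (∀ s : Tensor ℂ m, tensorRank s ≤ r → evalT s f = 0) → evalT t f = 0 := by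
  intro f hf
  have hmem := setOf_algBorderRank_le_subset_tensorZariskiClosure (K := ℂ) r
    (show t ∈ {t : Tensor ℂ m | algBorderRank t ≤ r} from ht)
  have key := (mem_tensorZariskiClosure_iff _ t).1 hmem f (fun s hs => by
    rw [← MvPolynomial.coe_aeval_eq_eval]
    exact hf s hs)
  rwa [← MvPolynomial.coe_aeval_eq_eval] at key

/-! ## §2 The laws in the route's zero-locus phrasing and their structured readings

The route spells the laws with no vocabulary beyond the summit's: hypothesis = «`t` passes every degree-`≤ m^c` test of
`σ_m`» in the orbit phrasing of `E` and `A`; conclusion = «`t` lies in the common zero locus of ALL polynomials vanishing on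
the rank-`≤ r` tensors», `r = m` (`G₁`, spelled raw below — no decl) resp. `r = ⌊m^{1+δ}⌋` (`G₃` = the route decl
`SecantTestsSoundUpToPolyLoss`).  By §1 these are exactly `bR(t) ≤ m` resp. `bR(t) ≤ m^{1+δ}`. -/

/-- **Reading of `G₁`** (the exact law, spelled raw — it has no route decl): «secants are cut out in polynomial degree» iff «passing the degree-`≤ m^c` tests of `σ_m` forces
`bR ≤ m`», eventually in `m`, with one absolute exponent `c`. [cite: BurgisserClausenShokrollahi1997, Thm. (20.3) (Alder)] -/
theorem secantsCutOut_raw_iff :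
    (∃ c m₀ : ℕ, ∀ m : ℕ, m₀ ≤ m → ∀ t : Fin m → Fin m → Fin m → ℂ, (∀ f : MvPolynomial (Fin m × Fin m × Fin m) ℂ, f.totalDegree ≤ m ^ c → (∀ A B C : Matrix (Fin m) (Fin m) ℂ, A.det ≠ 0 → B.det ≠ 0 → C.det ≠ 0 → MvPolynomial.aeval (fun p : Fin m × Fin m × Fin m => Literature.Computability.AlgebraicComplexity.actTensor A B C (Literature.Computability.AlgebraicComplexity.unitTensor ℂ m) p.1 p.2.1 p.2.2) f = 0) → MvPolynomial.aeval (fun p : Fin m × Fin m × Fin m => t p.1 p.2.1 p.2.2) f = 0) → ∀ f : MvPolynomial (Fin m × Fin m × Fin m) ℂ, (∀ s : Fin m → Fin m → Fin m → ℂ, Literature.Computability.AlgebraicComplexity.tensorRank s ≤ m → MvPolynomial.aeval (fun p : Fin m × Fin m × Fin m => s p.1 p.2.1 p.2.2) f = 0) → MvPolynomial.aeval (fun p : Fin m × Fin m × Fin m => t p.1 p.2.1 p.2.2) f = 0) ↔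
    ∃ c m₀ : ℕ, ∀ m : ℕ, m₀ ≤ m → ∀ t : Tensor ℂ m,
      (∀ f : MvPolynomial (Idx m) ℂ, f.totalDegree ≤ m ^ c → f ∈ orbitVanishing (unitTensor ℂ m) → evalT t f = 0) →
      algBorderRank t ≤ m := by
  constructor
  · rintro ⟨c, m₀, h⟩
    exact ⟨c, m₀, fun m hm t ht => algBorderRank_le_of_zeroLocus (h m hm t ht)⟩
  · rintro ⟨c, m₀, h⟩
    exact ⟨c, m₀, fun m hm t ht => zeroLocus_of_algBorderRank_le (h m hm t ht)⟩

/-- **Reading of `G₃`**: «tests confine to the secant `σ_{⌊m^{1+δ}⌋}`» iff «passing the degree-`≤ m^c` tests of `σ_m` forces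
`bR(t) ≤ m^{1+δ}`». [cite: BurgisserClausenShokrollahi1997, Thm. (20.3) (Alder)] -/
theorem secantTestsSoundUpToPolyLoss_iff : SecantTestsSoundUpToPolyLoss ↔
    ∀ δ : ℝ, 0 < δ → ∃ c m₀ : ℕ, ∀ m : ℕ, m₀ ≤ m → ∀ t : Tensor ℂ m,
      (∀ f : MvPolynomial (Idx m) ℂ, f.totalDegree ≤ m ^ c → f ∈ orbitVanishing (unitTensor ℂ m) → evalT t f = 0) →
      (algBorderRank t : ℝ) ≤ (m : ℝ) ^ (1 + δ) := by
  constructor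
  · intro h δ hδ
    obtain ⟨c, m₀, h⟩ := h δ hδ
    refine ⟨c, m₀, fun m hm t ht => ?_⟩
    have hbr : algBorderRank t ≤ ⌊(m : ℝ) ^ (1 + δ)⌋₊ := algBorderRank_le_of_zeroLocus (h m hm t ht)
    exact le_trans (by exact_mod_cast hbr) (Nat.floor_le (Real.rpow_nonneg (Nat.cast_nonneg _) _))
  · intro h δ hδ
    obtain ⟨c, m₀, h⟩ := h δ hδ
    refine ⟨c, m₀, fun m hm t ht => ?_⟩
    exact zeroLocus_of_algBorderRank_le (Nat.le_floor (h m hm t ht))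

/-! ## §3 The order of the laws -/

/-- `G₁ ⟹ G₃`: exact generation in degree `m^c` bounds border rank by `m ≤ m^{1+δ}`. [bookkeeping] -/
theorem testsBoundBorderRank_of_secantsCutOut
    (hG : ∃ c m₀ : ℕ, ∀ m : ℕ, m₀ ≤ m → ∀ t : Tensor ℂ m,
      (∀ f : MvPolynomial (Idx m) ℂ, f.totalDegree ≤ m ^ c → f ∈ orbitVanishing (unitTensor ℂ m) → evalT t f = 0) →
      algBorderRank t ≤ m) :
    ∀ δ : ℝ, 0 < δ → ∃ c m₀ : ℕ, ∀ m : ℕ, m₀ ≤ m → ∀ t : Tensor ℂ m,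
      (∀ f : MvPolynomial (Idx m) ℂ, f.totalDegree ≤ m ^ c → f ∈ orbitVanishing (unitTensor ℂ m) → evalT t f = 0) →
      (algBorderRank t : ℝ) ≤ (m : ℝ) ^ (1 + δ) := by
  intro δ hδ
  obtain ⟨c, m₀, h⟩ := hG
  refine ⟨c, max m₀ 1, fun m hm t ht => ?_⟩
  have hm₀ : m₀ ≤ m := (le_max_left _ _).trans hm
  have hm1 : (1 : ℝ) ≤ m := by exact_mod_cast (le_max_right _ _).trans hm
  calc (algBorderRank t : ℝ) ≤ m := by exact_mod_cast h m hm₀ t ht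
    _ = (m : ℝ) ^ (1 : ℝ) := (Real.rpow_one _).symm
    _ ≤ (m : ℝ) ^ (1 + δ) := Real.rpow_le_rpow_of_exponent_le hm1 (by linarith)

/-- `G₁ ⟹ A` (the gen-8 law `PolyDegreeTestBoundsAsymptoticRank`, by name): `R̃(t) ≤ bR(t) ≤ m ≤ m^{1+δ}`.
[cite: BurgisserClausenShokrollahi1997, Lemma (15.27)] -/
theorem polyDegreeTestBoundsAsymptoticRank_of_secantsCutOut
    (hG : ∃ c m₀ : ℕ, ∀ m : ℕ, m₀ ≤ m → ∀ t : Tensor ℂ m,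
      (∀ f : MvPolynomial (Idx m) ℂ, f.totalDegree ≤ m ^ c → f ∈ orbitVanishing (unitTensor ℂ m) → evalT t f = 0) →
      algBorderRank t ≤ m) :
    PolyDegreeTestBoundsAsymptoticRank := by
  obtain ⟨c, m₀, h⟩ := hG
  refine ⟨c, fun δ hδ => ⟨max m₀ 1, fun m hm t ht => ?_⟩⟩
  have hm₀ : m₀ ≤ m := (le_max_left _ _).trans hm
  have hm1 : (1 : ℝ) ≤ m := by exact_mod_cast (le_max_right _ _).trans hm
  have hbr : algBorderRank t ≤ m := h m hm₀ t ht
  calc asymptoticRank t ≤ algBorderRank t := asymptoticRank_le_algBorderRank t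
    _ ≤ (m : ℝ) := by exact_mod_cast hbr
    _ = (m : ℝ) ^ (1 : ℝ) := (Real.rpow_one _).symm
    _ ≤ (m : ℝ) ^ (1 + δ) := Real.rpow_le_rpow_of_exponent_le hm1 (by linarith)

/-! ## §4 The summit from the degree child and the weakest law -/

/-- Under `E` at a cell, `pad_m⟨n,n,n⟩` passes the degree-`≤ m^c` tests of `σ_m` (evaluate at `A = B = C = 1`).
[cite: BurgisserIkenmeyer2011, §5] -/
theorem pad_passesTests {c n m : ℕ} (h : n * n ≤ m)
    (hE : ∀ f : MvPolynomial (Idx m) ℂ, f.totalDegree ≤ m ^ c →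
      f ∈ orbitVanishing (unitTensor ℂ m) → f ∈ orbitVanishing (padMM ℂ n m h)) :
    ∀ f : MvPolynomial (Idx m) ℂ, f.totalDegree ≤ m ^ c → f ∈ orbitVanishing (unitTensor ℂ m) →
      evalT (padMM ℂ n m h) f = 0 := by
  intro f hd hf
  have h1 := hE f hd hf 1 1 1 (by simp) (by simp) (by simp)
  rwa [actTensor_one] at h1

/-- `bR(⟨n,n,n⟩) ≤ bR(pad_m⟨n,n,n⟩)`: `⟨n,n,n⟩` is the restriction of its padding to the embedded indices.
[cite: Blaser2013, Def. 6.1, Lemma 5.4] -/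
theorem algBorderRank_matMul_le_padMM {n m : ℕ} (h : n * n ≤ m) :
    algBorderRank (matMulTensor ℂ n n n) ≤ algBorderRank (padMM ℂ n m h) := by
  have hre : (fun a b c => padMM ℂ n m h (padIdx n m h a) (padIdx n m h b) (padIdx n m h c)) =
      matMulTensor ℂ n n n := by
    funext a b c
    exact padMM_padIdx h a b c
  have key := algBorderRank_precomp_le (padMM ℂ n m h) (padIdx n m h) (padIdx n m h) (padIdx n m h)
  rwa [hre] at key

/-- **`E ∧ G₃ ⟹ ω(ℂ) = 2`** (kernel).  Arithmetic: `τ = 2+δ`, `m = ⌈n^τ⌉ ≤ 2n^τ`, `n^δ ≥ 2`, `r = ⌊m^{1+δ}⌋ ≥ bR(⟨n,n,n⟩)`;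
Bini–Bläser: `ω log n ≤ log r ≤ (1+δ) log m ≤ (1+δ)(τ+δ) log n`, so `ω ≤ 2 + 5δ` for `δ ≤ 1/2`.
[cite: Blaser2013, Thm. 6.6] -/
theorem summit_of_noPolyDegreeObstruction_of_testsBoundBorderRank (hE : NoPolyDegreeObstruction)
    (hG : ∀ δ : ℝ, 0 < δ → ∃ c m₀ : ℕ, ∀ m : ℕ, m₀ ≤ m → ∀ t : Tensor ℂ m,
      (∀ f : MvPolynomial (Idx m) ℂ, f.totalDegree ≤ m ^ c → f ∈ orbitVanishing (unitTensor ℂ m) → evalT t f = 0) →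
      (algBorderRank t : ℝ) ≤ (m : ℝ) ^ (1 + δ)) :
    _root_.MatrixMultiplication := by
  have hE' := noPolyDegreeObstruction_iff.1 hE
  -- key estimate: `ω ≤ 2 + 5δ` for every `0 < δ ≤ 1/2`
  have key : ∀ δ : ℝ, 0 < δ → δ ≤ 1 / 2 → omega ℂ ≤ 2 + 5 * δ := by
    intro δ hδ hδh
    obtain ⟨c, m₀, hm₀⟩ := hG δ hδ
    obtain ⟨n₀, hn₀⟩ := hE' c (2 + δ) (by linarith)
    -- `n^δ ≥ 2` eventually
    have ht : Tendsto (fun n : ℕ => (n : ℝ) ^ δ) atTop atTop :=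
      (tendsto_rpow_atTop hδ).comp tendsto_natCast_atTop_atTop
    obtain ⟨N₁, hN₁⟩ := eventually_atTop.1 (ht.eventually_ge_atTop 2)
    -- choose `n`
    set n : ℕ := max (max n₀ m₀) (max N₁ 2) with hn_def
    have hn₀n : n₀ ≤ n := le_trans (le_max_left _ _) (le_max_left _ _)
    have hm₀n : m₀ ≤ n := le_trans (le_max_right _ _) (le_max_left _ _)
    have hN₁n : N₁ ≤ n := le_trans (le_max_left _ _) (le_max_right _ _)
    have hn2 : 2 ≤ n := le_trans (le_max_right _ _) (le_max_right _ _)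
    have hn1 : 1 ≤ n := le_trans (by norm_num) hn2
    have hn1r : (1 : ℝ) ≤ n := by exact_mod_cast hn1
    have hnpos : (0 : ℝ) < n := by exact_mod_cast (lt_of_lt_of_le (by norm_num) hn1)
    have hlogn : 0 < Real.log n := Real.log_pos (by exact_mod_cast (lt_of_lt_of_le (by norm_num) hn2))
    have hnδ : (2 : ℝ) ≤ (n : ℝ) ^ δ := hN₁ n hN₁n
    -- the scale `m = ⌈n^τ⌉`
    set τ : ℝ := 2 + δ with hτ
    set m : ℕ := ⌈(n : ℝ) ^ τ⌉₊ with hm_def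
    have hτm : (n : ℝ) ^ τ ≤ (m : ℝ) := Nat.le_ceil _
    have hnτ1 : (1 : ℝ) ≤ (n : ℝ) ^ τ := Real.one_le_rpow hn1r (by linarith)
    have hnτpos : (0 : ℝ) < (n : ℝ) ^ τ := lt_of_lt_of_le one_pos hnτ1
    have hm2 : (m : ℝ) ≤ 2 * (n : ℝ) ^ τ := by
      have := Nat.ceil_lt_add_one hnτpos.le
      rw [← hm_def] at this
      linarith
    have hmpos : (0 : ℝ) < m := lt_of_lt_of_le hnτpos hτm
    have hm1 : (1 : ℝ) ≤ m := hnτ1.trans hτm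
    have hnnm : n * n ≤ m := by
      have h2 : ((n * n : ℕ) : ℝ) ≤ (n : ℝ) ^ τ := by
        rw [Nat.cast_mul, ← sq, ← Real.rpow_natCast]
        exact Real.rpow_le_rpow_of_exponent_le hn1r (by norm_num [hτ]; linarith)
      exact_mod_cast h2.trans hτm
    have hm₀m : m₀ ≤ m := hm₀n.trans ((Nat.le_mul_self n).trans hnnm)
    -- the pad passes the tests, so `bR(pad) ≤ m^{1+δ}`, hence `bR(⟨n,n,n⟩) ≤ m^{1+δ}`
    have hpad : (algBorderRank (padMM ℂ n m hnnm) : ℝ) ≤ (m : ℝ) ^ (1 + δ) :=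
      hm₀ m hm₀m _ (pad_passesTests hnnm (hn₀ n m hn₀n hnnm hτm))
    have hchain : (algBorderRank (matMulTensor ℂ n n n) : ℝ) ≤ (m : ℝ) ^ (1 + δ) :=
      le_trans (by exact_mod_cast algBorderRank_matMul_le_padMM hnnm) hpad
    -- an integer border-rank bound `r = ⌊m^{1+δ}⌋ ≥ 1`
    set r : ℕ := ⌊(m : ℝ) ^ (1 + δ)⌋₊ with hr_def
    have hmδpos : (0 : ℝ) ≤ (m : ℝ) ^ (1 + δ) := Real.rpow_nonneg hmpos.le _
    have hmδ1 : (1 : ℝ) ≤ (m : ℝ) ^ (1 + δ) := Real.one_le_rpow hm1 (by linarith)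
    have hbrr : algBorderRank (matMulTensor ℂ n n n) ≤ r := Nat.le_floor hchain
    have hr1 : 1 ≤ r := by
      have : ((1 : ℕ) : ℝ) ≤ (m : ℝ) ^ (1 + δ) := by simpa using hmδ1
      exact Nat.le_floor this
    have hrle : (r : ℝ) ≤ (m : ℝ) ^ (1 + δ) := Nat.floor_le hmδpos
    have hrpos : (0 : ℝ) < r := by exact_mod_cast hr1
    -- Bini–Bläser: `ω ≤ log_n r`
    have hω : omega ℂ ≤ Real.logb n r := Blaser2013_thm66.cubic Blaser2013_thm66_holds ℂ hn2 hr1 hbrr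
    rw [Real.logb, le_div_iff₀ hlogn] at hω
    -- take logarithms
    have hlogr : Real.log r ≤ (1 + δ) * Real.log m := by
      have := Real.log_le_log hrpos hrle
      rwa [Real.log_rpow hmpos] at this
    have hlogm : Real.log m ≤ Real.log 2 + τ * Real.log n := by
      have := Real.log_le_log hmpos hm2
      rwa [Real.log_mul (by norm_num) hnτpos.ne', Real.log_rpow hnpos] at this
    have hlog2 : Real.log 2 ≤ δ * Real.log n := by
      have := Real.log_le_log (by norm_num) hnδ
      rwa [Real.log_rpow hnpos] at this
    have hδ1 : 0 ≤ 1 + δ := by linarith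
    have h3 : omega ℂ * Real.log n ≤ (1 + δ) * ((τ + δ) * Real.log n) := by
      calc omega ℂ * Real.log n ≤ Real.log r := hω
        _ ≤ (1 + δ) * Real.log m := hlogr
        _ ≤ (1 + δ) * (Real.log 2 + τ * Real.log n) := by gcongr
        _ ≤ (1 + δ) * (δ * Real.log n + τ * Real.log n) := by gcongr
        _ = (1 + δ) * ((τ + δ) * Real.log n) := by ring
    have h4 : omega ℂ ≤ (1 + δ) * (τ + δ) := by
      have := h3
      rw [← mul_assoc] at this
      exact le_of_mul_le_mul_right this hlogn
    rw [hτ] at h4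
    nlinarith [h4, hδ, hδh, sq_nonneg δ]
  refine MatrixMultiplication_iff.2 (le_antisymm ?_ (omega_two_le ℂ))
  refine le_of_forall_pos_le_add fun ε hε => ?_
  have h := key (min (ε / 5) (1 / 2)) (lt_min (by linarith) (by norm_num)) (min_le_right _ _)
  have : 5 * min (ε / 5) (1 / 2) ≤ ε := by
    have := min_le_left (ε / 5) (1 / 2)
    linarith
  linarith

/-- **`E ∧ G₁ ⟹ ω(ℂ) = 2`**. [cite: Blaser2013, Thm. 6.6] -/
theorem summit_of_noPolyDegreeObstruction_of_secantsCutOut (hE : NoPolyDegreeObstruction)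
    (hG : ∃ c m₀ : ℕ, ∀ m : ℕ, m₀ ≤ m → ∀ t : Tensor ℂ m,
      (∀ f : MvPolynomial (Idx m) ℂ, f.totalDegree ≤ m ^ c → f ∈ orbitVanishing (unitTensor ℂ m) → evalT t f = 0) →
      algBorderRank t ≤ m) :
    _root_.MatrixMultiplication :=
  summit_of_noPolyDegreeObstruction_of_testsBoundBorderRank hE (testsBoundBorderRank_of_secantsCutOut hG)

/-! ## §5 Lines beneath the residual: `G₃ ⟹ B`, `G₁ ⟹ B`, and `G ∧ E ⟹ D` -/

/-- **`G₃ ⟹ JointBlindnessDecides`** (the declared joint residual, item `stmt-MatrixMultiplication-30890`). [this node] -/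
theorem jointBlindnessDecides_of_testsBoundBorderRank
    (hG : ∀ δ : ℝ, 0 < δ → ∃ c m₀ : ℕ, ∀ m : ℕ, m₀ ≤ m → ∀ t : Tensor ℂ m,
      (∀ f : MvPolynomial (Idx m) ℂ, f.totalDegree ≤ m ^ c → f ∈ orbitVanishing (unitTensor ℂ m) → evalT t f = 0) →
      (algBorderRank t : ℝ) ≤ (m : ℝ) ^ (1 + δ)) :
    JointBlindnessDecides :=
  fun hj => rankEventuallyQuadratic_of_summit (summit_of_noPolyDegreeObstruction_of_testsBoundBorderRank hj.2 hG)

/-- **`G₁ ⟹ JointBlindnessDecides`**. [this node] -/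
theorem jointBlindnessDecides_of_secantsCutOut
    (hG : ∃ c m₀ : ℕ, ∀ m : ℕ, m₀ ≤ m → ∀ t : Tensor ℂ m,
      (∀ f : MvPolynomial (Idx m) ℂ, f.totalDegree ≤ m ^ c → f ∈ orbitVanishing (unitTensor ℂ m) → evalT t f = 0) →
      algBorderRank t ≤ m) :
    JointBlindnessDecides :=
  jointBlindnessDecides_of_testsBoundBorderRank (testsBoundBorderRank_of_secantsCutOut hG)

/-- With the degree child `E`, either law also gives the gen-6 residual `MultiplicityDecides` (indeed the summit). [this node] -/
theorem multiplicityDecides_of_noPolyDegreeObstruction_of_testsBoundBorderRank (hE : NoPolyDegreeObstruction)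
    (hG : ∀ δ : ℝ, 0 < δ → ∃ c m₀ : ℕ, ∀ m : ℕ, m₀ ≤ m → ∀ t : Tensor ℂ m,
      (∀ f : MvPolynomial (Idx m) ℂ, f.totalDegree ≤ m ^ c → f ∈ orbitVanishing (unitTensor ℂ m) → evalT t f = 0) →
      (algBorderRank t : ℝ) ≤ (m : ℝ) ^ (1 + δ)) :
    MultiplicityDecides :=
  fun _ => rankEventuallyQuadratic_of_summit (summit_of_noPolyDegreeObstruction_of_testsBoundBorderRank hE hG)

/-! ## §6 The route's aside by name: `G₁ ⟹ G₃`, `E ∧ G₃ ⟹ S`, `G₃ ⟹ B`, `E ∧ G₃ ⟹ D` -/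

/-- **`G₁ ⟹ G₃`** with `G₃` the route decl: the exact cut-out law (structured form, cf. `secantsCutOut_raw_iff`) implies
`SecantTestsSoundUpToPolyLoss`. -/
theorem secantTestsSoundUpToPolyLoss_of_secantsCutOut
    (h : ∃ c m₀ : ℕ, ∀ m : ℕ, m₀ ≤ m → ∀ t : Tensor ℂ m,
      (∀ f : MvPolynomial (Idx m) ℂ, f.totalDegree ≤ m ^ c → f ∈ orbitVanishing (unitTensor ℂ m) → evalT t f = 0) →
      algBorderRank t ≤ m) :
    SecantTestsSoundUpToPolyLoss :=
  secantTestsSoundUpToPolyLoss_iff.2 (testsBoundBorderRank_of_secantsCutOut h)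

/-- **`E ∧ G₃ ⟹ ω(ℂ) = 2`** for the route decls. [cite: Blaser2013, Thm. 6.6] -/
theorem summit_of_noPolyDegreeObstruction_of_secantTestsSoundUpToPolyLoss (hE : NoPolyDegreeObstruction)
    (hG : SecantTestsSoundUpToPolyLoss) : _root_.MatrixMultiplication :=
  summit_of_noPolyDegreeObstruction_of_testsBoundBorderRank hE (secantTestsSoundUpToPolyLoss_iff.1 hG)

/-- **`G₃ ⟹ JointBlindnessDecides`**: the weakest border-rank law discharges the declared joint residual. [this node] -/
theorem jointBlindnessDecides_of_secantTestsSoundUpToPolyLoss (hG : SecantTestsSoundUpToPolyLoss) :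
    JointBlindnessDecides :=
  jointBlindnessDecides_of_testsBoundBorderRank (secantTestsSoundUpToPolyLoss_iff.1 hG)

/-- `E ∧ G₃ ⟹ MultiplicityDecides` (the gen-6 residual `D`, item `stmt-MatrixMultiplication-29043`). [this node] -/
theorem multiplicityDecides_of_noPolyDegreeObstruction_of_secantTestsSoundUpToPolyLoss (hE : NoPolyDegreeObstruction)
    (hG : SecantTestsSoundUpToPolyLoss) : MultiplicityDecides :=
  multiplicityDecides_of_noPolyDegreeObstruction_of_testsBoundBorderRank hE (secantTestsSoundUpToPolyLoss_iff.1 hG)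

end Summit.MatrixMultiplication.MatrixMultiplication.Theorems.ObstructionDescentSecantGeneration

end
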